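import Summits.CriticalPhenomena.SAWScalingLimit.Theses.SAWRestrictionRigidity
import Summits.CriticalPhenomena.SAWScalingLimit.Theorems.SAWRestrictionRigidityRigidityIffRepairAndRado
import Summits.CriticalPhenomena.SAWScalingLimit.Theorems.SAWRestrictionRigidityRigidityDpDiscOfMarkFixing
import Summits.CriticalPhenomena.SAWScalingLimit.Theorems.SAWRestrictionRigidityRigidityRadoExtensionDiscDP
import Summits.CriticalPhenomena.SAWScalingLimit.Theorems.SAWRestrictionRigidityRigiditySleOfDPCovariance
import Summits.CriticalPhenomena.SAWScalingLimit.Theorems.SAWRestrictionRigidityRigidityDpCovarianceOfDisc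
import Literature.Probability.RandomPlanarGeometry.ConformalRestrictionHolds
import Literature.Probability.RandomPlanarGeometry.ConformalRestrictionCovariance
import Literature.Probability.RandomPlanarGeometry.RadoContinuity

/-!
# Skeleton (line `registered`, reshaped by lead c8 2026-08-17: v6, the MARK-FIXING cut) for crux `Rigidity` (stmt-CriticalPhenomena-1368), routes SAWRestrictionRigidity + SAWZoomRigidity

History. c2: scalar cocycle cut (core ≡ crux, p152583). c4: `Rigidity ↔ C′ ∧ AxiomsForceRado`
(p159660), C′ = "H1–H7 + Radó continuity ⇒ conformal covariance" (LSW04 §3.4.5's open problem),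
AxiomsForceRado ≡ `¬ NonRadoAxiomsFamily` (p159714/p168963; blocked, SAW-irrelevant). c7 (v5b): C′
cut at the reference disc — `stub_discCoreAnalytic` (covariance of two-marked unit-disc laws under
EVERY `Φ` univalent near the closed disc; open) + three bookkeeping stubs, all landed (p168392,
p168637, p168702), + `discCoreAnalytic_iff_repair` (p168875).

v6 (this file). NEW OBSERVATION: isotropy and the motion of the marks are OUTPUT, not input.
If the laws are covariant under conformal maps that FIX BOTH MARK POSITIONS (`a' = a`, `b' = b`),
then — with only the `k = 0` part of H5 (real dilations and translations), H1, H2, H7 — EVERY law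
is chordal SLE(8/3), hence the family is conformally covariant. Mechanism (`stub_sleOfMarkFixing`):
mark-fixing covariance + dilation/translation covariance = covariance within each CHORD-DIRECTION
class `u(D) = (b - a)/|b - a| ∈ S¹`; for a fixed direction `θ` the ROTATED family
`P^θ D := (R_D)_* P (R_D⁻¹ D)`, `R_D z = (u(D)/θ) z`, only ever compares laws of `P` inside the
single class `θ`, so it is conformally covariant, chordal, restriction, simple — and the tree's
LSW03 (`LawlerSchrammWerner2003_holds`, PROVED) makes every `P^θ D` the SLE(8/3) law; taking
`θ = u(D)` gives `P D` itself. Consequently the open content of C′ is covariance of the DISC law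
under MARK-FIXING univalent maps only — LSW's `(ℍ; 0, ∞)` restriction-semigroup covariance
(`Φ_A`, `A` a hull, plus the hyperbolic automorphisms fixing the marks), the smallest quantifier
range so far (v5b's core quantified over all univalent `Φ`, 4 more real parameters, and made
rotation covariance part of the open stub).

Stubs:
* A  `stub_axiomsForceRado` — unchanged (blocked on the construction `NonRadoAxiomsFamily`).
* B1 `stub_discCoreMarkFixing` — OPEN CORE (lead): H1–H7 + Radó ⇒ for every two-marked unit disc
     `D₀` and every `Φ` univalent on a neighbourhood of the closed disc with `Φ a = a`, `Φ b = b`: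
     `P (Φ D₀; a, b) = Φ_* P (D₀; a, b)`.
* B1½ `stub_dpDiscOfMarkFixing` — LANDED p172687 — bookkeeping (S): mark-fixing ⇒ DIRECTION-PRESERVING
     (`Φ b - Φ a = r (b - a)`, `r > 0`) at the analytic disc, by composing with the real dilation +
     translation re-pinning the marks and undoing it with H5 (`k = 0`).
* B2 `stub_radoExtensionDiscDP` — LANDED p172799 — bookkeeping (M): analytic ⇒ continuous-on-the-closed-disc,
     direction-preserving form (approximants `Aₙ ∘ Φ(rₙ ·)` with the complex-AFFINE correction
     `Aₙ → id` re-pinning the two image marks; Radó + dominated convergence as in p168392).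
* B3 `stub_dpCovarianceOfDisc` — LANDED p172898 — bookkeeping (M): disc form ⇒ direction-preserving covariance for
     ALL Dobrushin domains (p168637's Riemann + Carathéodory + Tietze argument with the disc
     pre-rotated so that the preimages of the marks are direction-parallel to them; p148398).
* B4 `stub_sleOfDPCovariance` — LANDED p172881 — LSW transport (M/L): direction-preserving covariance + H1 + H2 + H7
     ⇒ `∀ D, IsSLELaw (8/3) D (P D)` via the rotated families and `LawlerSchrammWerner2003_holds`.
Glue: `isConformallyCovariant_of_isSLELaw` and `Repair.rigidity_iff_repair_and_rado` (p159660).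
-/

namespace Summit.CriticalPhenomena.SAWScalingLimit.Cruxes.Rigidity.MarkFixing

open MeasureTheory
open Literature.Probability.RandomPlanarGeometry

/-- stub A (the SAW-irrelevant residue of the crux AS TYPED; unchanged from v4/v5): the seven lattice-exact axioms alone force Radó continuity of `D ↦ P D`. Literally `¬ NonRadoAxiomsFamily` (p159714, p168963); worker verdict (c7): `stub-blocked` on that construction; partial result p167897 (pinned-marks inner continuity). Not in print. -/
theorem stub_axiomsForceRado : ∀ P : Literature.Probability.RandomPlanarGeometry.ChordalFamily, P.IsChordal → P.IsRestriction → P.IsRestrictionMarkov → P.IsReversible → P.IsLatticeSimilarityCovariant → P.IsCarriedBySimpleCurves → P.IsRadoContinuous := by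
  sorry

/-- stub B1 (hardest; the OPEN CORE of the repaired crux C′ in MARK-FIXING disc form, held by the lead): under the seven axioms and Radó continuity, for every two-marked unit disc `D₀` (carrier `Metric.ball 0 1`, marks `a, b` on the circle), every `Φ : C(ℂ, ℂ)` complex differentiable and injective on an open neighbourhood `U` of the closed disc which FIXES BOTH MARKS (`Φ a = a`, `Φ b = b`), and every Dobrushin domain `D'` with carrier `Φ '' 𝔻` and the same marks `a, b`: `P D' = Φ_* (P D₀)`. In `(ℍ; 0, ∞)`-coordinates: covariance of the reference law under LSW's restriction semigroup (hull maps `Φ_A` and the dilations fixing `0, ∞`); no rotation, Möbius or moving-mark covariance is asked. Open in print (LSW04 §3.4.5). -/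
theorem stub_discCoreMarkFixing : ∀ P : Literature.Probability.RandomPlanarGeometry.ChordalFamily, P.IsChordal → P.IsRestriction → P.IsRestrictionMarkov → P.IsReversible → P.IsLatticeSimilarityCovariant → P.IsCarriedBySimpleCurves → P.IsRadoContinuous → ∀ (D₀ D' : Literature.Probability.RandomPlanarGeometry.DobrushinDomain) (Φ : C(ℂ, ℂ)) (U : Set ℂ), D₀.carrier = Metric.ball 0 1 → IsOpen U → closure D₀.carrier ⊆ U → DifferentiableOn ℂ Φ U → Set.InjOn Φ U → Φ (D₀.pt 0) = D₀.pt 0 → Φ (D₀.pt 1) = D₀.pt 1 → D'.carrier = Φ '' D₀.carrier → D'.pt 0 = D₀.pt 0 → D'.pt 1 = D₀.pt 1 → P D' = (P D₀).map (Literature.Probability.RandomPlanarGeometry.CurveClass.map Φ) := by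
  sorry

-- stub B1½ `stub_dpDiscOfMarkFixing`: LANDED p172687 (Theorems/SAWRestrictionRigidityRigidityDpDiscOfMarkFixing.lean), imported.

-- stub B2 `stub_radoExtensionDiscDP`: LANDED p172799 (Theorems/SAWRestrictionRigidityRigidityRadoExtensionDiscDP.lean), imported.

-- stub B3 `stub_dpCovarianceOfDisc`: LANDED p172898 (Theorems/SAWRestrictionRigidityRigidityDpCovarianceOfDisc.lean), imported.

-- stub B4 `stub_sleOfDPCovariance`: LANDED p172881 (Theorems/SAWRestrictionRigidityRigiditySleOfDPCovariance.lean), imported.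

/-- The repaired crux C′ (packaged form), a REAL proof from the B-stubs by name: mark-fixing
analytic disc core (B1, open) → (H5, B1½) direction-preserving analytic disc form → (Radó, B2)
direction-preserving continuous disc form → (uniformisation, B3) direction-preserving covariance of
all domains → (LSW transport, B4) every law is SLE(8/3) → (`isConformallyCovariant_of_isSLELaw`)
conformal covariance. -/
theorem repairedCore_of : ∀ P : Literature.Probability.RandomPlanarGeometry.ChordalFamily, P.IsChordal → P.IsRestriction → P.IsRestrictionMarkov → P.IsReversible → P.IsLatticeSimilarityCovariant → P.IsCarriedBySimpleCurves → P.IsRadoContinuous → P.IsConformallyCovariant :=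
  fun P hch hres hRM hrev hLS hS hRado =>
    ChordalFamily.isConformallyCovariant_of_isSLELaw
      (stub_sleOfDPCovariance P hch hres hS
        (stub_dpCovarianceOfDisc P
          (stub_radoExtensionDiscDP P hch hRado
            (stub_dpDiscOfMarkFixing P hLS
              (stub_discCoreMarkFixing P hch hres hRM hrev hLS hS hRado)))))

/-- Assembly (real proof, no `sorry` of its own): `Rigidity` BY NAME from the stubs through the
landed split `Repair.rigidity_iff_repair_and_rado` (p159660). -/
theorem Rigidity_of : Summit.CriticalPhenomena.SAWScalingLimit.Theses.SAWRestrictionRigidity.Rigidity :=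
  Summit.CriticalPhenomena.SAWScalingLimit.Cruxes.Rigidity.Repair.rigidity_iff_repair_and_rado.mpr
    ⟨repairedCore_of, stub_axiomsForceRado⟩

end Summit.CriticalPhenomena.SAWScalingLimit.Cruxes.Rigidity.MarkFixing
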